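import Literature.NumberTheory.EllipticCurves.NewformsMainLemmaTraceProofs
import Literature.NumberTheory.EllipticCurves.ModularSymbolsPeriodHomology
import HarnessLib

/-!
# The TRANSFER of cycles `H₁(X₀(N), ℤ) → H₁(X₀(L), ℤ)` (`N ∣ L`): the transpose of the trace
# `Tr^L_N = [Γ₀(L) 1 Γ₀(N)]` preserves period homology (route `EdixhovenFibreFiveSeven`, crux TDS57,
# `--supports`; Road A′ = Ihara-free L-TWIST, part 1/3)

Cell `pub/bsd-wall` (D-0145 line `route-BirchSwinnertonDyer-EdixhovenFibreFiveSeven`), seat `bsd-line-edix-p2`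
(prover). Route-free file: THEOREMS ONLY (no definition, no named fact, no `sorry`). BSD is not proved by this file.

WHY. The landed conditional closers of TDS57 (stmt-…-22227), KP57 (23810) and its children CORNER/LOW
(23883/23884), and of AKR crux #7 (20709) consume the lattice inclusion L-TWIST
`Λ(f) ⊆ τ(χ_q)·Λ(f ⊗ χ_q) + p·Λ(f)`, which the tree derives (`LTwist.lTwist_of_ihara3`, p591526) from the
cite-only THREE-COPY IHARA LEMMA `ModularForms.diamondRibet1997_iharaLemma_sq` through an `(x, 0, 0)`-LIFT of
cycles along `(α_*, β_*, γ_*) : H₁(X₀(M q²)) → H₁(X₀(M))³`. Road A′ (memo LTWIST-ROADS, evidence #7 on 22227)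
replaces the lift by the TRANSFER `α^* = (Tr^{Mq²}_M)^∨`: `(α_*, β_*, γ_*) α^* x = (q(q+1) x, q T_q x,
(T_q² − q − 1) x)`, hence `α^*x((f_χ)_χ) = ((q−1)((q+1)² − a_q²)/q)·x(f)` — no Ihara lemma, at the price of
the auxiliary-prime condition `a_q ≢ ±(q+1)`, `q ≢ 1 (mod p)`. This file supplies the one piece of
infrastructure the memo found missing in the tree, the transfer on INTEGRAL homology:

* `verticalIntegral_finset_sum` — `V_{Σ φᵢ} = Σ V_{φᵢ}` for cusp functions.
* `exists_perm_of_isDoubleCosetDecomp` — for representatives `a : ι → SL₂(ℤ)` of `Γ₀(L)∖Γ₀(N)` (an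
  `IsDoubleCosetDecomp Γ₀(L) Γ₀(N) 1 (mapGL ∘ a)` of `HeckeOperatorsDoubleCoset`) and `γ ∈ Γ₀(N)`: a
  permutation `σ` of `ι` and `h : ι → Γ₀(L)` with `aᵢ γ = hᵢ a_{σ i}` (the permutation action of `γ` on
  the cosets).
* `cuspSymbol_restrictLevel_eq_sum` — **the transfer formula** `{∞, γ∞}_{Tr F} = Σᵢ {∞, hᵢ∞}_F` for every
  `F ∈ S₂(Γ₀(L))` (`Tr F = Σᵢ F ∣ aᵢ`, `coe_restrictLevel_eq_sum`): with `V_φ(τ) = 2πi∫_{i∞}^τ φ`,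
  `V_{F∣aᵢ}(γτ) − V_{F∣aᵢ}(τ) = V_F(aᵢγτ) − V_F(aᵢτ)` (`verticalIntegral_smul_sub_eq`: the difference
  `V_F(aᵢ·) − V_{F∣aᵢ}(·)` is constant), `V_F(hᵢ a_{σi} τ) = V_F(a_{σi} τ) + {∞, hᵢ∞}_F`
  (`eichlerIntegral_smul_sub_holds`), and `Σᵢ V_F(a_{σ i}τ) = Σᵢ V_F(aᵢτ)` — Shimura 1971 §8.3 (8.3.2)
  read in weight 2 / the transfer `Ver : Γ₀(N)^{ab} → Γ₀(L)^{ab}` evaluated on period cocycles; Cremona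
  1997 §2.4 (the action of correspondences on `{α, β}`); Merel 1994 §1.2.
* `dualMap_restrictLevel_periodFunctional`, `dualMap_restrictLevel_mem_periodHomology_of_isDoubleCosetDecomp`
  — hence `(Tr^L_N)^∨ {∞, γ∞} = Σᵢ {∞, hᵢ∞}` and `(Tr^L_N)^∨ (periodHomology N) ⊆ periodHomology L` for
  any representatives in `SL₂(ℤ)`.
* `dualMap_restrictLevel_mem_periodHomology_mul` (`L = N p`, `p ∣ N`, representatives `(1 0; Nj 1)` of
  `isDoubleCosetDecomp_gamma0_mul_level`) and `dualMap_restrictLevel_mem_periodHomology_prime` (`L = M p`,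
  `p ∤ M`, representatives `β, (1 0; Mj 1)` of `isDoubleCosetDecomp_gamma0_beta`): the two prime steps, and
  `dualMap_restrictLevel_sq_mem_periodHomology`: the composite transfer
  `H₁(X₀(M)) → H₁(X₀(Mq)) → H₁(X₀(Mq²))` for a prime `q ∤ M` (the `α^*` of Road A′).

References: [Shimura1971] §3.4 (3.4.4), §8.3 (8.3.2); [CremonaAlgorithms1997] §2.1 (2.1.1), §2.4 (2.4.1)–(2.4.2);
[Merel1994] L. Merel, *Universal Fourier expansions of modular forms*, §1.2 (Hecke/transfer action on Manin
symbols); [DiamondShurman2005] §5.1 p. 166 case (3) (the trace as a double coset operator).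
-/

set_option autoImplicit false
-- the Theorems directory repeats the summit name (sibling precedent `SignedBaseChangeAssembly.lean`)
set_option linter.dupNamespace false

noncomputable section

open scoped MatrixGroups ModularForm

open CongruenceSubgroup UpperHalfPlane MeasureTheory Set Matrix.SpecialLinearGroup

namespace Summit.BirchSwinnertonDyer.BirchSwinnertonDyer.Theorems.CycleTransfer

open Literature.NumberTheory.EllipticCurves.ModularForms

/-! ### §1 Vertical integrals of finite sums of cusp functions -/

/-- `V_{Σᵢ φᵢ}(τ) = Σᵢ V_{φᵢ}(τ)` for cusp functions `φᵢ` (each `t ↦ φᵢ(τ + it)` is integrable on `(0, ∞)`,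
`IsCuspFunction.integrableOn_ray`). [folklore] -/
theorem verticalIntegral_finset_sum {ι : Type*} (s : Finset ι) {h : ι → ℝ} {φ : ι → ℍ → ℂ}
    (hφ : ∀ i ∈ s, IsCuspFunction (h i) (φ i)) (τ : ℍ) :
    verticalIntegral (∑ i ∈ s, φ i) τ = ∑ i ∈ s, verticalIntegral (φ i) τ := by
  simp only [verticalIntegral, Finset.sum_apply]
  rw [integral_finsetSum s fun i hi ↦ (hφ i hi).integrableOn_ray τ, Finset.mul_sum]

/-! ### §2 The permutation action of `γ ∈ Γ₀(N)` on coset representatives of `Γ₀(L)∖Γ₀(N)` -/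

variable {N L : ℕ}

/-- **Cosets are permuted.** Let `a : ι → SL₂(ℤ)`, `aᵢ ∈ Γ₀(N)`, represent the right cosets of `Γ₀(L)` in
`Γ₀(N)` (`Γ₀(L)·1·Γ₀(N) = ⊔ᵢ Γ₀(L) aᵢ`, an `IsDoubleCosetDecomp` in `GL₂(ℝ)`). For `γ ∈ Γ₀(N)` there are a
permutation `σ` of `ι` and `hᵢ ∈ Γ₀(L)` with `aᵢ γ = hᵢ a_{σ i}` (`σ i` = the index of the coset of `aᵢγ`;
`σ` is injective because distinct representatives lie in distinct cosets, hence bijective). [folklore] -/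
theorem exists_perm_of_isDoubleCosetDecomp {ι : Type*} [Fintype ι] (a : ι → SL(2, ℤ))
    (hdec : IsDoubleCosetDecomp ((Gamma0 L : Subgroup SL(2, ℤ)) : Subgroup (GL (Fin 2) ℝ))
      ((Gamma0 N : Subgroup SL(2, ℤ)) : Subgroup (GL (Fin 2) ℝ)) 1
      (fun i ↦ (mapGL ℝ (a i) : GL (Fin 2) ℝ)))
    (ha : ∀ i, a i ∈ Gamma0 N) (γ : Gamma0 N) :
    ∃ (σ : Equiv.Perm ι) (h : ι → Gamma0 L), ∀ i, a i * γ = (h i : SL(2, ℤ)) * a (σ i) := by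
  classical
  set Γ : Subgroup (GL (Fin 2) ℝ) := ((Gamma0 L : Subgroup SL(2, ℤ)) : Subgroup (GL (Fin 2) ℝ)) with hΓ
  set Γ' : Subgroup (GL (Fin 2) ℝ) := ((Gamma0 N : Subgroup SL(2, ℤ)) : Subgroup (GL (Fin 2) ℝ)) with hΓ'
  have hmemDC : ∀ g : SL(2, ℤ), g ∈ Gamma0 N →
      (mapGL ℝ g : GL (Fin 2) ℝ) ∈ DoubleCoset.doubleCoset (1 : GL (Fin 2) ℝ) (Γ : Set (GL (Fin 2) ℝ)) Γ' :=
    fun g hg ↦ DoubleCoset.mem_doubleCoset.mpr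
      ⟨1, Γ.one_mem, mapGL ℝ g, Subgroup.mem_map_of_mem _ hg, by rw [one_mul, one_mul]⟩
  have hex := fun i ↦ hdec.existsUnique _ (hmemDC (a i * (γ : SL(2, ℤ))) ((Gamma0 N).mul_mem (ha i) γ.2))
  choose σ hσ _ using hex
  have hmemL : ∀ i, a i * (γ : SL(2, ℤ)) * (a (σ i))⁻¹ ∈ Gamma0 L := fun i ↦ by
    have h1 : (mapGL ℝ (a i * (γ : SL(2, ℤ))) : GL (Fin 2) ℝ) * (mapGL ℝ (a (σ i)))⁻¹ ∈ Γ := hσ i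
    rw [← map_inv, ← map_mul] at h1
    exact (Subgroup.mem_map_iff_mem Matrix.SpecialLinearGroup.mapGL_injective).mp h1
  have hinj : Function.Injective σ := by
    intro i j hij
    have h1 : a i * (a j)⁻¹ ∈ Gamma0 L := by
      have h2 := (Gamma0 L).mul_mem (hmemL i) ((Gamma0 L).inv_mem (hmemL j))
      rw [hij] at h2
      convert h2 using 1
      group
    refine hdec.eq_of_mul_inv_mem (hmemDC (a i) (ha i)) ?_ ?_
    · rw [mul_inv_cancel]; exact Γ.one_mem
    · rw [← map_inv, ← map_mul]; exact Subgroup.mem_map_of_mem _ h1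
  refine ⟨Equiv.ofBijective σ hinj.bijective_of_finite, fun i ↦ ⟨_, hmemL i⟩, fun i ↦ ?_⟩
  change a i * (γ : SL(2, ℤ)) = a i * (γ : SL(2, ℤ)) * (a (σ i))⁻¹ * a (σ i)
  rw [inv_mul_cancel_right]

/-! ### §3 The transfer formula `{∞, γ∞}_{Tr F} = Σᵢ {∞, hᵢ∞}_F` -/

/-- **The transfer of cycles along `X₀(L) → X₀(N)`, evaluated on period cocycles.** With `a, σ, h` as in
`exists_perm_of_isDoubleCosetDecomp` (`aᵢ γ = hᵢ a_{σ i}`), for every `F ∈ S₂(Γ₀(L))`: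
`{∞, γ∞}_{Tr^L_N F} = Σᵢ {∞, hᵢ∞}_F`, where `Tr^L_N F = [Γ₀(L) 1 Γ₀(N)] F = Σᵢ F ∣₂ aᵢ`
(`restrictLevel`, `coe_restrictLevel_eq_sum`). Proof: `{∞, γ∞}_{TrF} = V_{TrF}(γτ) − V_{TrF}(τ)`,
`V_{TrF} = Σᵢ V_{F∣aᵢ}`, `V_{F∣aᵢ}(γτ) − V_{F∣aᵢ}(τ) = V_F(aᵢγτ) − V_F(aᵢτ) = V_F(a_{σi}τ) + {∞, hᵢ∞}_F − V_F(aᵢτ)`,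
and the `V_F(a·τ)` terms cancel in the sum over `i` (the transfer homomorphism on `H₁`, dual to the trace;
Shimura 1971 (8.3.2) in weight 2; Cremona 1997 §2.4). [cite: Shimura1971, §8.3 (8.3.2)]
[cite: CremonaAlgorithms1997, §2.4 (2.4.1)–(2.4.2)] -/
theorem cuspSymbol_restrictLevel_eq_sum [NeZero N] [NeZero L] {ι : Type*} [Fintype ι]
    (a : ι → SL(2, ℤ))
    (hdec : IsDoubleCosetDecomp ((Gamma0 L : Subgroup SL(2, ℤ)) : Subgroup (GL (Fin 2) ℝ))
      ((Gamma0 N : Subgroup SL(2, ℤ)) : Subgroup (GL (Fin 2) ℝ)) 1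
      (fun i ↦ (mapGL ℝ (a i) : GL (Fin 2) ℝ)))
    (γ : Gamma0 N) (σ : Equiv.Perm ι) (h : ι → Gamma0 L)
    (hσ : ∀ i, a i * γ = (h i : SL(2, ℤ)) * a (σ i)) (F : CuspForm (Gamma0 L) 2) :
    cuspSymbol (restrictLevel _ _ 2 F) γ = ∑ i, cuspSymbol F (h i) := by
  set TrF := restrictLevel ((Gamma0 L : Subgroup SL(2, ℤ)) : Subgroup (GL (Fin 2) ℝ))
    ((Gamma0 N : Subgroup SL(2, ℤ)) : Subgroup (GL (Fin 2) ℝ)) 2 F with hTrF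
  have hcoe : (⇑TrF : ℍ → ℂ) = ∑ i, (⇑F : ℍ → ℂ) ∣[(2 : ℤ)] (a i) := by
    rw [hTrF, coe_restrictLevel_eq_sum 2 _ _ hdec F]
    exact Finset.sum_congr rfl fun i _ ↦ rfl
  -- Eichler integrals of the trace
  have hE : ∀ τ : ℍ, eichlerIntegral TrF τ = ∑ i, verticalIntegral ((⇑F : ℍ → ℂ) ∣[(2 : ℤ)] (a i)) τ := by
    intro τ
    change verticalIntegral (⇑TrF) τ = _
    rw [hcoe, verticalIntegral_finset_sum _ (fun i _ ↦ isCuspFunction_slash F (a i))]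
  -- `V_F(aᵢ ·) − V_{F∣aᵢ}(·)` is constant
  have hc : ∀ i (τ τ' : ℍ), verticalIntegral (⇑F) (a i • τ) -
      verticalIntegral ((⇑F : ℍ → ℂ) ∣[(2 : ℤ)] (a i)) τ =
      verticalIntegral (⇑F) (a i • τ') - verticalIntegral ((⇑F : ℍ → ℂ) ∣[(2 : ℤ)] (a i)) τ' :=
    fun i ↦ verticalIntegral_smul_sub_eq (a i) (isCuspFunction_one F) (isCuspFunction_slash F (a i))
  -- periods of `F` along `hᵢ ∈ Γ₀(L)`
  have hper : ∀ i (τ : ℍ), verticalIntegral (⇑F) (((h i : Gamma0 L) : SL(2, ℤ)) • τ) -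
      verticalIntegral (⇑F) τ = cuspSymbol F (h i) :=
    fun i τ ↦ eichlerIntegral_smul_sub_holds F (h i) τ
  have key : ∀ i, verticalIntegral ((⇑F : ℍ → ℂ) ∣[(2 : ℤ)] (a i)) ((γ : SL(2, ℤ)) • UpperHalfPlane.I) -
      verticalIntegral ((⇑F : ℍ → ℂ) ∣[(2 : ℤ)] (a i)) UpperHalfPlane.I =
      verticalIntegral (⇑F) (a (σ i) • UpperHalfPlane.I) - verticalIntegral (⇑F) (a i • UpperHalfPlane.I) +
        cuspSymbol F (h i) := by
    intro i
    have e1 := hc i ((γ : SL(2, ℤ)) • UpperHalfPlane.I) UpperHalfPlane.I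
    have e2 : a i • ((γ : SL(2, ℤ)) • UpperHalfPlane.I) =
        ((h i : Gamma0 L) : SL(2, ℤ)) • (a (σ i) • UpperHalfPlane.I) := by
      rw [← mul_smul, hσ i, mul_smul]
    have e3 := hper i (a (σ i) • UpperHalfPlane.I)
    rw [e2] at e1
    linear_combination -e1 + e3
  rw [← eichlerIntegral_smul_sub_holds TrF γ UpperHalfPlane.I, hE, hE, ← Finset.sum_sub_distrib]
  simp_rw [key]
  rw [Finset.sum_add_distrib, Finset.sum_sub_distrib,
    Equiv.sum_comp σ (fun i ↦ verticalIntegral (⇑F) (a i • UpperHalfPlane.I)), sub_self, zero_add]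

/-- **The transfer on period functionals**: `(Tr^L_N)^∨ {∞, γ∞}_N = Σᵢ {∞, hᵢ∞}_L` (with `aᵢ γ = hᵢ a_{σ i}`).
[cite: Shimura1971, §8.3 (8.3.2)] -/
theorem dualMap_restrictLevel_periodFunctional [NeZero N] [NeZero L] {ι : Type*} [Fintype ι]
    (a : ι → SL(2, ℤ))
    (hdec : IsDoubleCosetDecomp ((Gamma0 L : Subgroup SL(2, ℤ)) : Subgroup (GL (Fin 2) ℝ))
      ((Gamma0 N : Subgroup SL(2, ℤ)) : Subgroup (GL (Fin 2) ℝ)) 1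
      (fun i ↦ (mapGL ℝ (a i) : GL (Fin 2) ℝ)))
    (γ : Gamma0 N) (σ : Equiv.Perm ι) (h : ι → Gamma0 L)
    (hσ : ∀ i, a i * γ = (h i : SL(2, ℤ)) * a (σ i)) :
    (restrictLevel ((Gamma0 L : Subgroup SL(2, ℤ)) : Subgroup (GL (Fin 2) ℝ))
      ((Gamma0 N : Subgroup SL(2, ℤ)) : Subgroup (GL (Fin 2) ℝ)) 2).dualMap (periodFunctional N γ) =
      ∑ i, periodFunctional L (h i) := by
  ext F
  rw [LinearMap.dualMap_apply, periodFunctional_apply, cuspSymbol_restrictLevel_eq_sum a hdec γ σ h hσ F,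
    LinearMap.sum_apply]
  simp only [periodFunctional_apply]

/-- **The transfer carries `H₁(X₀(N), ℤ)` into `H₁(X₀(L), ℤ)`** (given any system of representatives of
`Γ₀(L)∖Γ₀(N)` in `SL₂(ℤ)`): `(Tr^L_N)^∨ (periodHomology N) ⊆ periodHomology L`.
[cite: Shimura1971, §8.3 (8.3.2)] [cite: CremonaAlgorithms1997, §2.4] -/
theorem dualMap_restrictLevel_mem_periodHomology_of_isDoubleCosetDecomp [NeZero N] [NeZero L]
    {ι : Type*} [Fintype ι] (a : ι → SL(2, ℤ))
    (hdec : IsDoubleCosetDecomp ((Gamma0 L : Subgroup SL(2, ℤ)) : Subgroup (GL (Fin 2) ℝ))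
      ((Gamma0 N : Subgroup SL(2, ℤ)) : Subgroup (GL (Fin 2) ℝ)) 1
      (fun i ↦ (mapGL ℝ (a i) : GL (Fin 2) ℝ)))
    (ha : ∀ i, a i ∈ Gamma0 N) {x : Module.Dual ℂ (CuspForm (Gamma0 N) 2)} (hx : x ∈ periodHomology N) :
    (restrictLevel ((Gamma0 L : Subgroup SL(2, ℤ)) : Subgroup (GL (Fin 2) ℝ))
      ((Gamma0 N : Subgroup SL(2, ℤ)) : Subgroup (GL (Fin 2) ℝ)) 2).dualMap x ∈ periodHomology L := by
  have hx' : x ∈ (periodHomology N : Set (Module.Dual ℂ (CuspForm (Gamma0 N) 2))) := hx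
  rw [coe_periodHomology_eq_range] at hx'
  obtain ⟨γ, rfl⟩ := hx'
  obtain ⟨σ, h, hσ⟩ := exists_perm_of_isDoubleCosetDecomp a hdec ha γ
  rw [dualMap_restrictLevel_periodFunctional a hdec γ σ h hσ]
  exact AddSubgroup.sum_mem _ fun i _ ↦ periodFunctional_mem_periodHomology L (h i)

/-! ### §4 The two prime steps and the composite transfer `H₁(X₀(M)) → H₁(X₀(Mq²))` -/

/-- **Transfer along `X₀(Np) → X₀(N)` for `p ∣ N`** (representatives `(1 0; Nj 1)`, `j mod p`,
`isDoubleCosetDecomp_gamma0_mul_level`). [folklore] -/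
theorem dualMap_restrictLevel_mem_periodHomology_mul (p : ℕ) [Fact p.Prime] (N L : ℕ) [NeZero N]
    [NeZero L] (hL : L = N * p) (hpN : p ∣ N)
    {x : Module.Dual ℂ (CuspForm (Gamma0 N) 2)} (hx : x ∈ periodHomology N) :
    (restrictLevel ((Gamma0 L : Subgroup SL(2, ℤ)) : Subgroup (GL (Fin 2) ℝ))
      ((Gamma0 N : Subgroup SL(2, ℤ)) : Subgroup (GL (Fin 2) ℝ)) 2).dualMap x ∈ periodHomology L :=
  dualMap_restrictLevel_mem_periodHomology_of_isDoubleCosetDecomp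
    (fun j : Fin p ↦ Matrix.SpecialLinearGroup.transpose (ModularGroup.T ^ ((N : ℤ) * ((j : ℕ) : ℤ))))
    (isDoubleCosetDecomp_gamma0_mul_level p N L hL hpN)
    (fun _ ↦ LU_mem_gamma0 N (dvd_mul_right _ _)) hx

/-- **Transfer along `X₀(Mp) → X₀(M)` for `p ∤ M`** (representatives `β`, `(1 0; Mj 1)`,
`isDoubleCosetDecomp_gamma0_beta`, `exists_beta`). [folklore] -/
theorem dualMap_restrictLevel_mem_periodHomology_prime (p : ℕ) [Fact p.Prime] (M N : ℕ) [NeZero M]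
    [NeZero N] (hN : N = M * p) (hpM : ¬ p ∣ M)
    {x : Module.Dual ℂ (CuspForm (Gamma0 M) 2)} (hx : x ∈ periodHomology M) :
    (restrictLevel ((Gamma0 N : Subgroup SL(2, ℤ)) : Subgroup (GL (Fin 2) ℝ))
      ((Gamma0 M : Subgroup SL(2, ℤ)) : Subgroup (GL (Fin 2) ℝ)) 2).dualMap x ∈ periodHomology N := by
  obtain ⟨β, hβ10, hβ11⟩ := exists_beta p M hpM
  have hβ : β ∈ Gamma0 M := by rw [Gamma0_mem, hβ10]; simp
  set a : Option (Fin p) → SL(2, ℤ) := fun i ↦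
    i.elim β (fun j ↦ Matrix.SpecialLinearGroup.transpose (ModularGroup.T ^ ((M : ℤ) * ((j : ℕ) : ℤ)))) with ha_def
  have hdec : IsDoubleCosetDecomp ((Gamma0 N : Subgroup SL(2, ℤ)) : Subgroup (GL (Fin 2) ℝ))
      ((Gamma0 M : Subgroup SL(2, ℤ)) : Subgroup (GL (Fin 2) ℝ)) 1
      (fun i ↦ (mapGL ℝ (a i) : GL (Fin 2) ℝ)) := by
    have heq : (fun i ↦ (mapGL ℝ (a i) : GL (Fin 2) ℝ)) = fun i : Option (Fin p) ↦
        i.elim (mapGL ℝ β : GL (Fin 2) ℝ)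
          (fun j ↦ (mapGL ℝ (Matrix.SpecialLinearGroup.transpose (ModularGroup.T ^ ((M : ℤ) * ((j : ℕ) : ℤ)))) :
            GL (Fin 2) ℝ)) := by
      funext i; cases i <;> rfl
    rw [heq]
    exact isDoubleCosetDecomp_gamma0_beta p M N hN β hβ10 hβ11
  refine dualMap_restrictLevel_mem_periodHomology_of_isDoubleCosetDecomp a hdec ?_ hx
  rintro (_ | j)
  · exact hβ
  · exact LU_mem_gamma0 M (dvd_mul_right _ _)

/-- **The transfer `α^* : H₁(X₀(M), ℤ) → H₁(X₀(Mq²), ℤ)` of Road A′** for a prime `q ∤ M`: the composite of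
the two prime steps `M → Mq → Mq²` (`(Tr^{Mq²}_{Mq})^∨ ∘ (Tr^{Mq}_M)^∨`) preserves period homology.
[cite: Shimura1971, §8.3 (8.3.2)] -/
theorem dualMap_restrictLevel_sq_mem_periodHomology (q : ℕ) [Fact q.Prime] (M : ℕ) [NeZero M]
    [NeZero (M * q)] [NeZero (M * q ^ 2)] (hqM : ¬ q ∣ M)
    {x : Module.Dual ℂ (CuspForm (Gamma0 M) 2)} (hx : x ∈ periodHomology M) :
    (restrictLevel ((Gamma0 (M * q ^ 2) : Subgroup SL(2, ℤ)) : Subgroup (GL (Fin 2) ℝ))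
        ((Gamma0 (M * q) : Subgroup SL(2, ℤ)) : Subgroup (GL (Fin 2) ℝ)) 2).dualMap
      ((restrictLevel ((Gamma0 (M * q) : Subgroup SL(2, ℤ)) : Subgroup (GL (Fin 2) ℝ))
        ((Gamma0 M : Subgroup SL(2, ℤ)) : Subgroup (GL (Fin 2) ℝ)) 2).dualMap x) ∈
      periodHomology (M * q ^ 2) :=
  dualMap_restrictLevel_mem_periodHomology_mul q (M * q) (M * q ^ 2) (by ring) (dvd_mul_left q M)
    (dualMap_restrictLevel_mem_periodHomology_prime q M (M * q) rfl hqM hx)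

end Summit.BirchSwinnertonDyer.BirchSwinnertonDyer.Theorems.CycleTransfer

end
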